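import Literature.Computability.AlgebraicComplexity.SymmetricDetCircuitEval
import Literature.Computability.AlgebraicComplexity.SymmetricCircuitSubstitution
import Literature.Computability.AlgebraicComplexity.SymmetricCircuitScaledInputs
import Literature.Computability.AlgebraicComplexity.SymmetricCircuitPullback
import Literature.Computability.AlgebraicComplexity.SymmetricCircuitConstOutputs
import Literature.Computability.AlgebraicComplexity.SymmetricCircuitPairing
import Literature.Computability.AlgebraicComplexity.SymmetricCircuitHadamard
import Literature.Computability.AlgebraicComplexity.SymmetricCircuitFibreFold
import Literature.Computability.AlgebraicComplexity.LRPencilOfMatrix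
import Literature.Computability.AlgebraicComplexity.DeterminantalComplexityProofs
import Literature.Computability.AlgebraicComplexity.StandardFamiliesProofs
import HarnessLib

/-!
# ValiantsHypothesis / SymPencil — crux `EquivariantSdcNotQP` (stmt-ValiantsHypothesis-17792),
# line `Cruxes/SdcThesis/Lines/birth_EquivariantSdcNotQP.lean`, registered stub `stub_toSymmetricCircuit`

The registered stub `stub_toSymmetricCircuit` (size M of the line PERMIFY-TO-DAWAR–WILSENACH) is
PROVED here, verbatim as registered: an affine pencil `A'` of size `m'` with `det A' = per_n` on which
every DIAGONAL substitution `x_ij ↦ x_{σ i, σ j}` (`σ ∈ 𝔖_n`) is undone by a congruence with a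
permutation matrix, `A'(σ · x) = P_τ A' P_τᵀ` for some `τ ∈ 𝔖_{m'}`, is computed by a diagonally
`𝔖_n`-symmetric labelled arithmetic circuit (Dawar–Wilsenach 2025, Defs. 2.2, 3.6, 3.7; tree
`LabelledArithCircuit`, `IsSymmetric`) with at most `(m' + 2) ^ 8` gates.

## Proof

* The pairs `(σ, τ) ∈ 𝔖_n × 𝔖_{m'}` with `A'_{τ a, τ b} = A'_{ab}(σ · x)` for all `a, b` form a
  SUBGROUP `H` (`exists_liftSubgroup`), which by hypothesis surjects onto `𝔖_n`; `H` acts on the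
  variables `X = [n] × [n]` through `σ` and on the matrix positions `Y = [m'] × [m']` through `τ`
  (both diagonally; `MulAction.compHom`, local to the proof).
* The AFFINE INPUT LAYER `(A'_{ab})_{(a,b) ∈ Y}` is an `H`-equivariant family, assembled as an
  `H`-symmetric circuit with outputs indexed by `Y` from the tree's closure toolkit for symmetric
  circuits: the inputs (`exists_scaledInputs` with `t = 1`), pulled back to `Y × X`
  (`exists_pullback`), the `H`-invariant constant family of coefficients `c_{(ab),(ij)}`
  (`exists_constOutputs`; invariance is `coeff_rename_mapDomain`), pairing and Hadamard product
  (`c_{(ab),(ij)} · x_ij`), pairing with the constant terms and the fibre sum along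
  `(Y × X) ⊕ Y → Y` (`exists_fibreSum`), which by the affine decomposition
  `eq_affine_of_totalDegree_le_one` computes `A'_{ab}`.
* SUBSTITUTION (`IsSymmetric.exists_substitution`) of this layer into Le Verrier's `𝔖_{m'}`-symmetric
  determinant circuit (`exists_isSymmetric_circuit_detPoly`, Dawar–Wilsenach Thm. 4.1 = the landed
  support `DetCalibration`, stmt-10344), which is `H`-symmetric through the projection `H → 𝔖_{m'}`
  (`isSymmetric_compHom`); the value is `det A' = per_n` (`AlgHom.map_det`,
  `Matrix.mvPolynomialX_mapMatrix_aeval`).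
* `H ↠ 𝔖_n` turns `H`-symmetry into `𝔖_n`-symmetry (`isSymmetric_of_compHom_surjective`); the size is
  `≤ 2n² + 1 + 4 m'² n² + 3 m'² + (m' + 2)⁴ ≤ (m' + 2)⁸` because `n ≤ m'` (`deg per_n = n ≤ m'`,
  `totalDegree_perPoly_holds`, `totalDegree_le_of_hasDetRepr_holds`).

Honest framing: this closes only the size-M stub of the line; the load-bearing stub `stub_permify`
(linear lifts ⇒ permutation lifts) and the crux `SymPencil.EquivariantSdcNotQP` remain OPEN;
`VP ≠ VNP` is NOT proved and nothing here is progress on it. No new definitions, no named facts.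
-/

noncomputable section

-- `Summit.ValiantsHypothesis.ValiantsHypothesis.…` is the tree's mandated single-conjunct layout
-- (Sub = Summit), so the duplicated namespace component is intended.
set_option linter.dupNamespace false

namespace Summit.ValiantsHypothesis.ValiantsHypothesis.Theorems.SymPencilEquivariantSdcNotQP

open Literature.Computability.AlgebraicComplexity MvPolynomial Matrix

/-! ### Symmetry along a homomorphism -/

/-- **Restriction of symmetry along a homomorphism** (single output): if `C` is `Γ`-symmetric and
`φ : Γ' →* Γ`, then `C` is `Γ'`-symmetric for the pulled-back action of `Γ'` on the variables
(Dawar–Wilsenach Def. 3.7; the action on the one-element output index type is immaterial).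
[cite: DawarWilsenach2025, Def. 3.7] -/
theorem isSymmetric_compHom {K : Type*} {X : Type*} {G : Type*} {Γ Γ' : Type*} [Group Γ] [Group Γ']
    [MulAction Γ X] [MulAction Γ Unit] [MulAction Γ' Unit] (φ : Γ' →* Γ)
    (C : LabelledArithCircuit K X Unit G) (h : C.IsSymmetric Γ) :
    @LabelledArithCircuit.IsSymmetric K X Unit G Γ' _ (MulAction.compHom X φ) ‹MulAction Γ' Unit› C := by
  letI : MulAction Γ' X := MulAction.compHom X φ
  intro γ'
  obtain ⟨π, hπ⟩ := h (φ γ')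
  refine ⟨π, hπ.children_apply, fun g => ?_, fun y => ?_⟩
  · rw [hπ.label_apply]
    cases C.label g <;> rfl
  · exact hπ.output_smul y

/-- **Descent of symmetry along a surjective homomorphism** (single output): if `C` is
`Γ'`-symmetric for the action of `Γ'` on the variables pulled back along a SURJECTIVE `φ : Γ' →* Γ`,
then `C` is `Γ`-symmetric (Dawar–Wilsenach Def. 3.7). [cite: DawarWilsenach2025, Def. 3.7] -/
theorem isSymmetric_of_compHom_surjective {K : Type*} {X : Type*} {G : Type*} {Γ Γ' : Type*}
    [Group Γ] [Group Γ'] [MulAction Γ X] [MulAction Γ Unit] [MulAction Γ' Unit] (φ : Γ' →* Γ)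
    (hφ : Function.Surjective φ) (C : LabelledArithCircuit K X Unit G)
    (h : @LabelledArithCircuit.IsSymmetric K X Unit G Γ' _ (MulAction.compHom X φ) ‹MulAction Γ' Unit› C) :
    C.IsSymmetric Γ := by
  letI : MulAction Γ' X := MulAction.compHom X φ
  intro γ
  obtain ⟨γ', rfl⟩ := hφ γ
  obtain ⟨π, hπ⟩ := h γ'
  refine ⟨π, hπ.children_apply, fun g => ?_, fun y => ?_⟩
  · rw [hπ.label_apply]
    cases C.label g <;> rfl
  · exact hπ.output_smul y

/-! ### Permutation-matrix congruences, entrywise -/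

/-- Entrywise form of a permutation-matrix congruence with constant permutation matrices:
`(P_τ · M · P_τᵀ)_{ab} = M_{τ a, τ b}`. [folklore] -/
theorem permMatrix_map_C_conj_apply {σ : Type*} {m : ℕ} (τ : Equiv.Perm (Fin m))
    (M : Matrix (Fin m) (Fin m) (MvPolynomial σ ℂ)) (a b : Fin m) :
    ((τ.permMatrix ℂ).map MvPolynomial.C * M * ((τ.permMatrix ℂ)ᵀ).map MvPolynomial.C :
      Matrix (Fin m) (Fin m) (MvPolynomial σ ℂ)) a b = M (τ a) (τ b) := by
  have hP : (τ.permMatrix ℂ).map (MvPolynomial.C : ℂ → MvPolynomial σ ℂ) =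
      τ.permMatrix (MvPolynomial σ ℂ) := by
    refine Matrix.ext fun i j => ?_
    simp only [Matrix.map_apply, PEquiv.toMatrix_apply]
    split_ifs
    · exact map_one _
    · exact map_zero _
  have hPt : ((τ.permMatrix ℂ)ᵀ).map (MvPolynomial.C : ℂ → MvPolynomial σ ℂ) =
      (τ.permMatrix (MvPolynomial σ ℂ))ᵀ := by
    rw [Matrix.transpose_map, hP]
  rw [hP, hPt, Matrix.transpose_permMatrix, Equiv.Perm.permMatrix, Equiv.Perm.permMatrix,
    PEquiv.toMatrix_toPEquiv_mul, PEquiv.mul_toMatrix_toPEquiv]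
  simp [Equiv.Perm.inv_def]

/-! ### The lift group -/

/-- The pairs `(σ, τ) ∈ 𝔖_n × 𝔖_{m'}` such that the diagonal substitution `σ` on the entries of `A'`
is the relabelling of the matrix positions by `τ` form a subgroup of `𝔖_n × 𝔖_{m'}`. [folklore] -/
theorem exists_liftSubgroup {n m' : ℕ} (A' : Matrix (Fin m') (Fin m') (MvPolynomial (Fin n × Fin n) ℂ)) :
    ∃ H : Subgroup (Equiv.Perm (Fin n) × Equiv.Perm (Fin m')),
      ∀ p, p ∈ H ↔ ∀ a b, MvPolynomial.rename (fun ij : Fin n × Fin n => p.1 • ij) (A' a b) =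
        A' (p.2 a) (p.2 b) := by
  refine ⟨{ carrier := {p | ∀ a b, MvPolynomial.rename (fun ij : Fin n × Fin n => p.1 • ij) (A' a b) =
              A' (p.2 a) (p.2 b)}
            mul_mem' := ?_
            one_mem' := ?_
            inv_mem' := ?_ }, fun p => Iff.rfl⟩
  · intro p q hp hq a b
    simp only [Set.mem_setOf_eq] at hp hq ⊢
    have hcomp : (fun ij : Fin n × Fin n => (p * q).1 • ij) =
        (fun ij : Fin n × Fin n => p.1 • ij) ∘ (fun ij : Fin n × Fin n => q.1 • ij) := by
      funext ij
      simp [mul_smul]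
    rw [hcomp, ← MvPolynomial.rename_rename, hq, hp]
    rfl
  · intro a b
    simp only [Prod.fst_one, one_smul, Prod.snd_one, Equiv.Perm.coe_one, id_eq]
    exact MvPolynomial.rename_id_apply _
  · intro p hp a b
    simp only [Set.mem_setOf_eq] at hp ⊢
    have h1 := hp (p.2⁻¹ a) (p.2⁻¹ b)
    simp only [Equiv.Perm.coe_inv, Equiv.apply_symm_apply] at h1
    rw [Prod.snd_inv, ← h1, MvPolynomial.rename_rename]
    have hcomp : ((fun ij : Fin n × Fin n => p⁻¹.1 • ij) ∘ fun ij : Fin n × Fin n => p.1 • ij) = id := by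
      funext ij
      simp
    rw [hcomp]
    exact MvPolynomial.rename_id_apply _

/-! ### Fibre sums along `(Y × X) ⊕ Y → Y` -/

/-- The fibre of `y` under `(Y × X) ⊕ Y → Y`, `inl (y', x) ↦ y'`, `inr y' ↦ y'`, is
`{inl (y, x) : x} ∪ {inr y}`. [folklore] -/
theorem sum_filter_fibre {Y X M : Type*} [Fintype Y] [Fintype X] [DecidableEq Y] [AddCommMonoid M]
    (v : (Y × X) ⊕ Y → M) (y : Y) :
    ∑ z ∈ Finset.univ.filter (fun z => Sum.elim Prod.fst id z = y), v z =
      v (Sum.inr y) + ∑ x, v (Sum.inl (y, x)) := by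
  have hinj : Function.Injective fun x : X => (Sum.inl (y, x) : (Y × X) ⊕ Y) := by
    intro x x' h
    simpa using h
  have hnot : (Sum.inr y : (Y × X) ⊕ Y) ∉ (Finset.univ : Finset X).map ⟨_, hinj⟩ := by simp
  have hset : Finset.univ.filter (fun z : (Y × X) ⊕ Y => Sum.elim Prod.fst id z = y) =
      Finset.cons (Sum.inr y) ((Finset.univ : Finset X).map ⟨_, hinj⟩) hnot := by
    ext z
    simp only [Finset.mem_filter, Finset.mem_univ, true_and, Finset.mem_cons, Finset.mem_map,
      Function.Embedding.coeFn_mk]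
    cases z with
    | inl w =>
      obtain ⟨y', x⟩ := w
      simp only [Sum.elim_inl]
      constructor
      · rintro rfl
        exact Or.inr ⟨x, rfl⟩
      · rintro (h | ⟨a, h⟩)
        · exact absurd h Sum.inl_ne_inr
        · simp only [Sum.inl.injEq, Prod.mk.injEq] at h
          exact h.1.symm
    | inr y' =>
      simp only [Sum.elim_inr, id_eq]
      constructor
      · rintro rfl
        exact Or.inl rfl
      · rintro (h | ⟨a, h⟩)
        · exact Sum.inr_injective h
        · exact absurd h Sum.inl_ne_inr
  rw [hset, Finset.sum_cons, Finset.sum_map]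
  rfl

/-! ### Size arithmetic -/

/-- `2n² + 1 + 4 m² n² + 3 m² + (m+2)⁴ ≤ (m+2)⁸` for `n ≤ m`. [folklore] -/
theorem size_arith (n m : ℕ) (h : n ≤ m) :
    2 * (n * n) + 1 + 4 * ((m * m) * (n * n)) + 3 * (m * m) + (m + 2) ^ 4 ≤ (m + 2) ^ 8 := by
  set t : ℕ := m + 2 with ht
  have hnn : n * n ≤ m * m := Nat.mul_le_mul h h
  have hm : m * m ≤ t ^ 4 := by
    have h1 : m ≤ t := by omega
    have h2 : m * m ≤ t * t := Nat.mul_le_mul h1 h1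
    have h3 : 1 ≤ t * t := by nlinarith
    calc m * m ≤ t * t := h2
      _ ≤ (t * t) * (t * t) := Nat.le_mul_of_pos_right _ (by omega)
      _ = t ^ 4 := by ring
  have hmn : (m * m) * (n * n) ≤ t ^ 4 := by
    have h1 : m ≤ t := by omega
    have h2 : m * m ≤ t * t := Nat.mul_le_mul h1 h1
    calc (m * m) * (n * n) ≤ (m * m) * (m * m) := Nat.mul_le_mul_left _ hnn
      _ ≤ (t * t) * (t * t) := Nat.mul_le_mul h2 h2
      _ = t ^ 4 := by ring
  have h16 : 16 ≤ t ^ 4 := by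
    have h1 : 2 ≤ t := by omega
    calc 16 = 2 ^ 4 := by norm_num
      _ ≤ t ^ 4 := Nat.pow_le_pow_left h1 4
  have h1t : 1 ≤ t ^ 4 := by omega
  calc 2 * (n * n) + 1 + 4 * ((m * m) * (n * n)) + 3 * (m * m) + t ^ 4
      ≤ 2 * t ^ 4 + t ^ 4 + 4 * t ^ 4 + 3 * t ^ 4 + t ^ 4 := by omega
    _ = 11 * t ^ 4 := by ring
    _ ≤ t ^ 4 * t ^ 4 := Nat.mul_le_mul_right _ (by omega)
    _ = t ^ 8 := by ring

/-! ### The stub -/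

/-- **Explicit form** of the registered stub with the exponent `e = 8`: an affine pencil `A'` of
size `m'` with `det A' = per_n`, on which every diagonal substitution `x_{ij} ↦ x_{σ i, σ j}` acts by a
permutation-matrix congruence `P_τ A' P_τᵀ`, is computed by a diagonally `𝔖_n`-symmetric labelled
arithmetic circuit with at most `(m' + 2) ^ 8` gates (affine input layer substituted into
Dawar–Wilsenach's Le Verrier determinant circuit, Thm. 4.1).
[cite: DawarWilsenach2025, Thm. 4.1, Defs. 2.2, 3.6, 3.7] -/
theorem toSymmetricCircuit_card_le (n m' : ℕ) (A' : Matrix (Fin m') (Fin m') (MvPolynomial (Fin n × Fin n) ℂ))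
    (hA' : IsAffineDetRepr (perPoly (Fin n) ℂ) A')
    (hperm : ∀ σ : Equiv.Perm (Fin n), ∃ τ : Equiv.Perm (Fin m'),
      A'.map (MvPolynomial.rename fun ij : Fin n × Fin n => (σ ij.1, σ ij.2)) =
        (τ.permMatrix ℂ).map MvPolynomial.C * A' * ((τ.permMatrix ℂ)ᵀ).map MvPolynomial.C) :
    ∃ (G : Type) (_ : Fintype G) (C : LabelledArithCircuit ℂ (Fin n × Fin n) Unit G),
      C.IsSymmetric (Equiv.Perm (Fin n)) ∧ C.eval (C.output ()) = perPoly (Fin n) ℂ ∧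
        Fintype.card G ≤ (m' + 2) ^ 8 := by
  -- the lift group `H ≤ 𝔖_n × 𝔖_{m'}` and its surjection onto `𝔖_n`
  obtain ⟨H, hH⟩ := exists_liftSubgroup A'
  have hsurj : ∀ σ : Equiv.Perm (Fin n), ∃ γ : H, (γ : Equiv.Perm (Fin n) × Equiv.Perm (Fin m')).1 = σ := by
    intro σ
    obtain ⟨τ, hτ⟩ := hperm σ
    refine ⟨⟨(σ, τ), (hH (σ, τ)).2 fun a b => ?_⟩, rfl⟩
    have h := congrFun (congrFun hτ a) b
    rw [Matrix.map_apply, permMatrix_map_C_conj_apply] at h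
    exact h
  let φ₁ : H →* Equiv.Perm (Fin n) := (MonoidHom.fst _ _).comp H.subtype
  let φ₂ : H →* Equiv.Perm (Fin m') := (MonoidHom.snd _ _).comp H.subtype
  have hφ₁ : Function.Surjective φ₁ := fun σ => by
    obtain ⟨γ, hγ⟩ := hsurj σ
    exact ⟨γ, hγ⟩
  -- notation for the two index sets and the actions of `H`
  let X : Type := Fin n × Fin n
  let Y : Type := Fin m' × Fin m'
  letI instX : MulAction H X := MulAction.compHom X φ₁
  letI instY : MulAction H Y := MulAction.compHom Y φ₂
  have hmem : ∀ (γ : H) (a b : Fin m'),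
      MvPolynomial.rename (fun ij : X => γ • ij) (A' a b) =
        A' ((γ : Equiv.Perm (Fin n) × Equiv.Perm (Fin m')).2 a)
          ((γ : Equiv.Perm (Fin n) × Equiv.Perm (Fin m')).2 b) :=
    fun γ a b => (hH _).1 γ.2 a b
  -- (1) the inputs `x_ij`, as a family indexed by `X`, pulled back to `Y × X`
  obtain ⟨G₁, _, S, hSsym, hSval, hScard⟩ :=
    LabelledArithCircuit.exists_scaledInputs (X := X) H (1 : ℂ)
  obtain ⟨G₂, _, P, hPsym, hPval, hPcard⟩ :=
    hSsym.exists_pullback (Y' := Y × X) Prod.snd (fun γ z => rfl)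
  -- (2) the coefficients `c_{(ab),(ij)} = [x_ij] A'_{ab}`: an `H`-invariant constant family on `Y × X`
  have hc : ∀ (γ : H) (z : Y × X),
      MvPolynomial.coeff (Finsupp.single (γ • z).2 1) (A' (γ • z).1.1 (γ • z).1.2) =
        MvPolynomial.coeff (Finsupp.single z.2 1) (A' z.1.1 z.1.2) := by
    intro γ z
    change MvPolynomial.coeff (Finsupp.single (γ • z.2) 1)
        (A' ((γ : Equiv.Perm (Fin n) × Equiv.Perm (Fin m')).2 z.1.1)
          ((γ : Equiv.Perm (Fin n) × Equiv.Perm (Fin m')).2 z.1.2)) = _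
    rw [← hmem γ z.1.1 z.1.2,
      show Finsupp.single (γ • z.2) 1 = Finsupp.mapDomain (fun ij : X => γ • ij) (Finsupp.single z.2 1)
        from Finsupp.mapDomain_single.symm,
      MvPolynomial.coeff_rename_mapDomain _ (MulAction.injective γ)]
  obtain ⟨G₃, _, K₁, hK₁sym, hK₁val, hK₁card⟩ :=
    LabelledArithCircuit.exists_constOutputs (Γ := H) X
      (fun z : Y × X => MvPolynomial.coeff (Finsupp.single z.2 1) (A' z.1.1 z.1.2)) hc
  -- (3) pairing and Hadamard product: `c_{(ab),(ij)} · x_ij` on `Y × X`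
  obtain ⟨G₄, _, Q, hQsym, hQl, hQr, hQcard⟩ := hK₁sym.exists_pairing hPsym
  obtain ⟨G₅, _, Hd, hHdsym, hHdval, hHdcard⟩ := hQsym.exists_hadamard
  -- (4) the constant terms `c_{ab} = A'_{ab}(0)`: an `H`-invariant constant family on `Y`
  have hc₀ : ∀ (γ : H) (y : Y),
      MvPolynomial.coeff 0 (A' (γ • y).1 (γ • y).2) = MvPolynomial.coeff 0 (A' y.1 y.2) := by
    intro γ y
    change MvPolynomial.coeff 0
        (A' ((γ : Equiv.Perm (Fin n) × Equiv.Perm (Fin m')).2 y.1)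
          ((γ : Equiv.Perm (Fin n) × Equiv.Perm (Fin m')).2 y.2)) = _
    rw [← hmem γ y.1 y.2, ← MvPolynomial.constantCoeff_eq, MvPolynomial.constantCoeff_rename]
  obtain ⟨G₆, _, K₀, hK₀sym, hK₀val, hK₀card⟩ :=
    LabelledArithCircuit.exists_constOutputs (Γ := H) X
      (fun y : Y => MvPolynomial.coeff 0 (A' y.1 y.2)) hc₀
  -- (5) pairing with the constant terms and the fibre sum along `(Y × X) ⊕ Y → Y`: the entries
  obtain ⟨G₇, _, R, hRsym, hRl, hRr, hRcard⟩ := hHdsym.exists_pairing hK₀sym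
  obtain ⟨G₈, _, L, hLsym, hLval, hLcard⟩ :=
    hRsym.exists_fibreSum (Sum.elim Prod.fst id : (Y × X) ⊕ Y → Y)
      (fun γ z => by cases z <;> rfl) (fun y => ⟨Sum.inr y, rfl⟩)
  have hLentry : ∀ y : Y, L.eval (L.output y) = A' y.1 y.2 := by
    intro y
    rw [hLval, sum_filter_fibre]
    conv_rhs => rw [LRPencil.eq_affine_of_totalDegree_le_one (A' y.1 y.2) (hA'.1 y.1 y.2)]
    simp only [hRl, hRr, hHdval, hQl, hQr, hK₁val, hPval, hSval, hK₀val, map_one, one_mul]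
    rfl
  -- (6) substitution into Le Verrier's symmetric determinant circuit
  obtain ⟨G₉, _, D, hDsym, hDval, hDcard⟩ := exists_isSymmetric_circuit_detPoly ℂ m'
  have hDsym' : @LabelledArithCircuit.IsSymmetric ℂ Y Unit G₉ H _ instY inferInstance D :=
    isSymmetric_compHom φ₂ D hDsym
  obtain ⟨G, _, F, hFsym, hFval, hFcard⟩ := hLsym.exists_substitution hDsym'
  refine ⟨G, inferInstance, F, isSymmetric_of_compHom_surjective φ₁ hφ₁ F hFsym, ?_, ?_⟩
  · -- value: `det A' = per_n`
    rw [hFval, hDval, show (fun y : Y => L.eval (L.output y)) = fun y : Y => A' y.1 y.2 from funext hLentry,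
      detPoly, AlgHom.map_det, Matrix.mvPolynomialX_mapMatrix_aeval]
    exact hA'.2
  · -- size
    have hdeg : (perPoly (Fin n) ℂ).totalDegree ≤ m' :=
      totalDegree_le_of_hasDetRepr_holds (show HasDetRepr (perPoly (Fin n) ℂ) m' from ⟨A', hA'⟩)
    rw [totalDegree_perPoly_holds, Fintype.card_fin] at hdeg
    have hX : Fintype.card X = n * n := by
      simp [X, Fintype.card_prod, Fintype.card_fin]
    have hY : Fintype.card Y = m' * m' := by
      simp [Y, Fintype.card_prod, Fintype.card_fin]
    have hYX : Fintype.card (Y × X) = (m' * m') * (n * n) := by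
      rw [Fintype.card_prod, hX, hY]
    rw [hX] at hScard
    rw [hYX] at hPcard hK₁card hHdcard
    rw [hY] at hK₀card hLcard
    have h8 : Fintype.card G₈ ≤ 2 * (n * n) + 1 + 4 * ((m' * m') * (n * n)) + 3 * (m' * m') := by
      omega
    calc Fintype.card G ≤ Fintype.card G₈ + Fintype.card G₉ := hFcard
      _ ≤ 2 * (n * n) + 1 + 4 * ((m' * m') * (n * n)) + 3 * (m' * m') + (m' + 2) ^ 4 :=
          Nat.add_le_add h8 hDcard
      _ ≤ (m' + 2) ^ 8 := size_arith n m' hdeg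

/-- **stub_toSymmetricCircuit** (registered stub of crux `SymPencil.EquivariantSdcNotQP`,
stmt-ValiantsHypothesis-17792, line `birth_EquivariantSdcNotQP`; signature VERBATIM as registered).
A pencil with `det = per_n` on which the diagonal substitutions `x_{ij} ↦ x_{σ i, σ j}` act by
conjugation with permutation matrices is computed — together with Dawar–Wilsenach's polynomial-size
`𝔖`-symmetric determinant circuits (ToC 2025 Thm 4.1, Le Verrier; tree
`exists_isSymmetric_circuit_detPoly`) — by a diagonally `𝔖_n`-symmetric labelled circuit of size
polynomial in its size; `e = 8` by `toSymmetricCircuit_card_le`.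
[cite: DawarWilsenach2025, Thm. 4.1, Defs. 2.2, 3.6, 3.7] -/
theorem stub_toSymmetricCircuit :
    ∃ e : ℕ, ∀ (n m' : ℕ) (A' : Matrix (Fin m') (Fin m') (MvPolynomial (Fin n × Fin n) ℂ)),
      IsAffineDetRepr (perPoly (Fin n) ℂ) A' →
      (∀ σ : Equiv.Perm (Fin n), ∃ τ : Equiv.Perm (Fin m'),
        A'.map (MvPolynomial.rename fun ij : Fin n × Fin n => (σ ij.1, σ ij.2)) =
          (τ.permMatrix ℂ).map MvPolynomial.C * A' * ((τ.permMatrix ℂ)ᵀ).map MvPolynomial.C) →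
      ∃ (G : Type) (_ : Fintype G) (C : LabelledArithCircuit ℂ (Fin n × Fin n) Unit G),
        C.IsSymmetric (Equiv.Perm (Fin n)) ∧ C.eval (C.output ()) = perPoly (Fin n) ℂ ∧
          Fintype.card G ≤ (m' + 2) ^ e :=
  ⟨8, toSymmetricCircuit_card_le⟩

end Summit.ValiantsHypothesis.ValiantsHypothesis.Theorems.SymPencilEquivariantSdcNotQP

end
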